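import Literature.ModelTheory.PseudofiniteFields.DefinableSetsFiniteFieldsProofs
import Literature.ModelTheory.PseudofiniteFields.FiniteFieldTheory
import Mathlib.ModelTheory.Algebra.Ring.FreeCommRing
import HarnessLib

/-!
# Definable sets over finite fields — the CDM Main Theorem from Prop. (3.3) and the
# pseudo-finite clause of Prop. (2.7) (proofs)

Third proof file of the programme around the named fact
`Literature.ModelTheory.PseudofiniteFields.ChatzidakisVanDenDriesMacintyre1992_mainTheorem`
(Z. Chatzidakis, L. van den Dries, A. Macintyre, *Definable sets over finite fields*, J. reine
angew. Math. **427** (1992) 107–135, Main Theorem = Thm. (3.7)). The sibling file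
`DefinableSetsFiniteFieldsProofs.lean` formalizes all of §3 of the paper and ends with
`mainTheorem_of_prop33_of_prop27`: the Main Theorem from its two printed external inputs,
CDM Prop. (3.3) (Lang–Weil for arbitrary affine algebraic sets) and the FINITE-FIELD clause of
CDM Prop. (2.7) ("Such an equivalence also holds for all sufficiently large enriched finite
fields"). The paper proves that clause from the principal, PSEUDO-FINITE clause of (2.7) "by pure
logic" (p. 118, last paragraph of the proof of (2.7)); the pure logic — compactness over the
theory of finite fields — is `FiniteField.eventually_realize_forall_of_pseudoFinite` of
`FiniteFieldTheory.lean`. This file carries out that step, so that the Main Theorem now rests on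
(3.3) and on (2.7) exactly as principally stated, for enriched pseudo-finite fields
(`mainTheorem_of_prop33_of_prop27psf`).

## What is proved here (sorry-free; theorems only: no definitions, no named facts)

* `exists_term_coeff_mul`, `mul_eq_X_pow_add_sum_iff`, `exists_formula_mul_eq`,
  `exists_formula_irreducible` — **irreducibility of a monic polynomial of fixed degree is an
  elementary property of its coefficients**: for every `n ≥ 1` there is a formula `Irr_n(c)` of
  the language of rings, `c = (c_0, …, c_{n-1})`, such that in EVERY field `K`,
  `K ⊨ Irr_n(c) ↔ Xⁿ + c_{n-1}X^{n-1} + ⋯ + c_0` is irreducible over `K` (`Irr_n` says: for no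
  `1 ≤ j ≤ n − 1` are there monic polynomials of degrees `j`, `n − j` with the given lower
  coefficients whose product has the coefficients `c`; the coefficients of such a product are
  integer polynomials in the unknowns, i.e. ring terms, `FirstOrder.Ring.termOfFreeCommRing`).
  Hence (`exists_formula_enrichment`) "`c` is an enrichment of depth `B`" — CDM (2.6): for each
  `n = k + 2 ≤ B + 1` the constants `c_{n,i}` are the coefficients of an irreducible monic
  polynomial of degree `n` — is expressed by one ring formula `Enr_B(c)`, uniformly in all fields.
  [folklore; cite: ChatzidakisVanDenDriesMacintyre1992, (2.6)]
* `prop27_finite_of_psf` — **the finite-field clause of CDM (2.7) from its pseudo-finite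
  clause**: if for every ring formula `φ(X)` there are enrichment depth `B` and ring terms
  `g_1, …, g_L` in `(C, X, T)` with `φ(x) ↔ ⋀_l ∃t g_l(c, x, t) = 0` in every enriched
  pseudo-finite field `(K, c)` (an infinite model of the theory of finite fields together with an
  enrichment `c`), then the same equivalence, with the same `B` and `g_l`, holds in every enriched
  finite field with at least `q₀ = q₀(φ)` elements. Proof as printed ("by pure logic"): the
  statement `∀c ∀x (Enr_B(c) → (φ(x) ↔ ⋀_l ∃t g_l(c, x, t) = 0))` is a single sentence of the
  language of rings true in all pseudo-finite fields, hence in all sufficiently large finite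
  fields by compactness (`FiniteField.eventually_realize_forall_of_pseudoFinite`).
  [cite: ChatzidakisVanDenDriesMacintyre1992, Prop. (2.7), p. 118]
* `mainTheorem_of_prop33_of_prop27psf` — **the CDM Main Theorem from CDM Prop. (3.3) and the
  pseudo-finite clause of CDM Prop. (2.7)**, both verbatim as printed (module docstring of the
  section `PrintedInputs` of `DefinableSetsFiniteFieldsProofs.lean` for the rendering
  conventions: `d ≤ n` for `d ≤ dim V`; enrichment constants `c ⟨k, i⟩` = coefficient of `T^i`
  of the irreducible monic polynomial of degree `k + 2`; `g_l` ring terms in `(C, X, T)`).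
  [cite: ChatzidakisVanDenDriesMacintyre1992, Prop. 3.3, Prop. 2.7, Thm. 3.7]

* `realize_sentence_of_forall_finite`, `realize_formula_of_forall_finite` — the converse
  transfer: a ring sentence (a uniform property) true in all finite fields with `≥ q₀` elements is
  true in every pseudo-finite field ("`|K| ≥ q₀ → σ`" belongs to the theory of finite fields);
  `exists_monic_irreducible_of_model_finiteFieldTheory` — **a pseudo-finite field has irreducible
  polynomials of every positive degree** (the existence half of "exactly one extension of each
  degree", CDM (2.5)), by transfer of `∃c Irr_m(c)`.
  [cite: ChatzidakisVanDenDriesMacintyre1992, p. 110, (2.3), (2.5)]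

What remains external after this file: CDM Prop. (3.3) (⇐ Lang–Weil [LangWeil1954, Thm. 1] in
all dimensions + the bounds (1.7)) and the pseudo-finite clause of CDM Prop. (2.7) (⇐ van den
Dries' positive existential normal form (2.4) for perfect PAC fields, the coding (2.2), and the
fact (2.3)/(2.5) that infinite models of the theory of finite fields are pseudo-finite, i.e. Weil's
theorem on curves); neither is in the tree.

## References

* [ChatzidakisVanDenDriesMacintyre1992] Z. Chatzidakis, L. van den Dries, A. Macintyre, Definable
  sets over finite fields, J. reine angew. Math. 427 (1992) 107–135, (2.6), Prop. (2.7) and its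
  proof (p. 118), Prop. (3.3), Thm. (3.7).
* [Ax1968] J. Ax, The elementary theory of finite fields, Ann. of Math. 88 (1968) 239–271 (the
  theory of pseudo-finite fields).
-/

namespace Literature.ModelTheory.PseudofiniteFields

open FirstOrder FirstOrder.Language FirstOrder.Ring
open scoped Polynomial

universe u

/-! ### Irreducibility of a monic polynomial of fixed degree is elementary in the coefficients -/

section IrreducibilityIsElementary

open Polynomial

/-- `X^d + Σ_{i<d} a_i X^i` is monic (the tail has degree `< d`:
`Polynomial.degree_sum_fin_lt`) … [folklore] -/
theorem monic_X_pow_add_sum {K : Type u} [Semiring K] {d : ℕ} (a : Fin d → K) :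
    (X ^ d + ∑ i : Fin d, C (a i) * X ^ (i : ℕ)).Monic :=
  monic_X_pow_add (degree_sum_fin_lt a)

/-- … of degree `d` … [folklore] -/
theorem natDegree_X_pow_add_sum {K : Type u} [Semiring K] [Nontrivial K] {d : ℕ}
    (a : Fin d → K) : (X ^ d + ∑ i : Fin d, C (a i) * X ^ (i : ℕ)).natDegree = d := by
  rw [natDegree_add_eq_left_of_degree_lt, natDegree_X_pow]
  rw [degree_X_pow]
  exact degree_sum_fin_lt a

/-- … with `s`-th coefficient `a_s` for `s < d`. [folklore] -/
theorem coeff_X_pow_add_sum_of_lt {K : Type u} [Semiring K] {d : ℕ} (a : Fin d → K) {s : ℕ}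
    (hs : s < d) : (X ^ d + ∑ i : Fin d, C (a i) * X ^ (i : ℕ)).coeff s = a ⟨s, hs⟩ := by
  rw [coeff_add, coeff_X_pow, if_neg hs.ne, zero_add, finsetSum_coeff]
  simp_rw [coeff_C_mul_X_pow]
  rw [Finset.sum_eq_single ⟨s, hs⟩]
  · simp
  · intro i _ hi
    rw [if_neg]
    intro h
    exact hi (Fin.ext h.symm)
  · intro h
    exact (h (Finset.mem_univ _)).elim

/-- A monic polynomial of degree `d` is `X^d + Σ_{i<d} (coeff f i) X^i`. [folklore] -/
theorem X_pow_add_sum_coeff_eq {K : Type u} [Semiring K] {f : K[X]} (hf : f.Monic) {d : ℕ}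
    (hd : f.natDegree = d) : X ^ d + ∑ i : Fin d, C (f.coeff i) * X ^ (i : ℕ) = f := by
  subst hd
  rw [Fin.sum_univ_eq_sum_range (fun i => C (f.coeff i) * X ^ i) f.natDegree]
  exact hf.as_sum.symm

/-- Two monic polynomials with prescribed lower coefficients, of degrees `j` and `n − j`
(`j ≤ n`), multiply to the monic polynomial of degree `n` with lower coefficients `c` iff the
first `n` coefficients of their product are `c`. [folklore] -/
theorem mul_eq_X_pow_add_sum_iff {K : Type u} [CommRing K] [Nontrivial K] {n j : ℕ} (hj : j ≤ n)
    (a : Fin j → K) (b : Fin (n - j) → K) (c : Fin n → K) :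
    (X ^ j + ∑ u : Fin j, C (a u) * X ^ (u : ℕ)) *
          (X ^ (n - j) + ∑ w : Fin (n - j), C (b w) * X ^ (w : ℕ)) =
        X ^ n + ∑ i : Fin n, C (c i) * X ^ (i : ℕ) ↔
      ∀ s : Fin n,
        ((X ^ j + ∑ u : Fin j, C (a u) * X ^ (u : ℕ)) *
            (X ^ (n - j) + ∑ w : Fin (n - j), C (b w) * X ^ (w : ℕ))).coeff s = c s := by
  have hAm := monic_X_pow_add_sum a
  have hBm := monic_X_pow_add_sum b
  have hpm := monic_X_pow_add_sum c
  have hABm := hAm.mul hBm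
  have hABd : ((X ^ j + ∑ u : Fin j, C (a u) * X ^ (u : ℕ)) *
      (X ^ (n - j) + ∑ w : Fin (n - j), C (b w) * X ^ (w : ℕ))).natDegree = n := by
    rw [hAm.natDegree_mul hBm, natDegree_X_pow_add_sum, natDegree_X_pow_add_sum]
    omega
  have hpd := natDegree_X_pow_add_sum c
  constructor
  · intro h s
    rw [h, coeff_X_pow_add_sum_of_lt c s.2]
  · intro h
    ext m
    rcases lt_trichotomy m n with hm | rfl | hm
    · rw [h ⟨m, hm⟩, coeff_X_pow_add_sum_of_lt c hm]
    · have h1 := hABm.coeff_natDegree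
      have h2 := hpm.coeff_natDegree
      rw [hABd] at h1
      rw [hpd] at h2
      rw [h1, h2]
    · rw [coeff_eq_zero_of_natDegree_lt (by rw [hABd]; exact hm),
        coeff_eq_zero_of_natDegree_lt (by rw [hpd]; exact hm)]

/-- **The coefficients of a product of two monic polynomials with indeterminate lower
coefficients are ring terms in those indeterminates**: there are terms `τ_s(a, b)` of the language
of rings with `τ_s(a, b) = coeff_s ((X^j + Σ a_u X^u)(X^{n−j} + Σ b_w X^w))` in every commutative
ring (namely the coefficients of the generic product over the free commutative ring, read back as
terms by `FirstOrder.Ring.termOfFreeCommRing`). [folklore] -/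
theorem exists_term_coeff_mul (n j : ℕ) :
    ∃ τ : ℕ → Language.ring.Term (Fin j ⊕ Fin (n - j)),
      ∀ (K : Type u) [CommRing K] [CompatibleRing K] (i : Fin j ⊕ Fin (n - j) → K) (s : ℕ),
        (τ s).realize i =
          ((X ^ j + ∑ u : Fin j, C (i (Sum.inl u)) * X ^ (u : ℕ)) *
            (X ^ (n - j) + ∑ w : Fin (n - j), C (i (Sum.inr w)) * X ^ (w : ℕ))).coeff s := by
  let R := FreeCommRing (Fin j ⊕ Fin (n - j))
  let A : R[X] := X ^ j + ∑ u : Fin j, C (FreeCommRing.of (Sum.inl u)) * X ^ (u : ℕ)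
  let B : R[X] := X ^ (n - j) + ∑ w : Fin (n - j), C (FreeCommRing.of (Sum.inr w)) * X ^ (w : ℕ)
  refine ⟨fun s => termOfFreeCommRing ((A * B).coeff s), fun K _ _ i s => ?_⟩
  rw [realize_termOfFreeCommRing, ← Polynomial.coeff_map, Polynomial.map_mul]
  congr 2
  · simp only [A, Polynomial.map_add, Polynomial.map_pow, Polynomial.map_X, Polynomial.map_sum,
      Polynomial.map_mul, Polynomial.map_C, FreeCommRing.lift_of]
  · simp only [B, Polynomial.map_add, Polynomial.map_pow, Polynomial.map_X, Polynomial.map_sum,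
      Polynomial.map_mul, Polynomial.map_C, FreeCommRing.lift_of]

/-- **"`Xⁿ + c_{n−1}X^{n−1} + ⋯ + c_0` has a monic factorization of degrees `(j, n − j)`" is an
elementary property of `c`**, uniformly in all fields. [folklore] -/
theorem exists_formula_mul_eq (n j : ℕ) (hj : j ≤ n) :
    ∃ θ : Language.ring.Formula (Fin n),
      ∀ (K : Type u) [Field K] [CompatibleRing K] (c : Fin n → K),
        θ.Realize c ↔
          ∃ (a : Fin j → K) (b : Fin (n - j) → K),
            (X ^ j + ∑ u : Fin j, C (a u) * X ^ (u : ℕ)) *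
                (X ^ (n - j) + ∑ w : Fin (n - j), C (b w) * X ^ (w : ℕ)) =
              X ^ n + ∑ i : Fin n, C (c i) * X ^ (i : ℕ) := by
  obtain ⟨τ, hτ⟩ := exists_term_coeff_mul.{u} n j
  refine ⟨(Formula.iInf fun s : Fin n =>
      Term.equal ((τ s).relabel Sum.inr) (var (Sum.inl s))).iExs (Fin j ⊕ Fin (n - j)),
    fun K _ _ c => ?_⟩
  rw [Formula.realize_iExs]
  constructor
  · rintro ⟨i, hi⟩
    refine ⟨i ∘ Sum.inl, i ∘ Sum.inr, ?_⟩
    rw [mul_eq_X_pow_add_sum_iff hj]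
    intro s
    have hs := (Formula.realize_iInf.1 hi) s
    rw [Formula.realize_equal, Term.realize_relabel, Sum.elim_comp_inr, hτ] at hs
    simpa using hs
  · rintro ⟨a, b, hab⟩
    refine ⟨Sum.elim a b, Formula.realize_iInf.2 fun s => ?_⟩
    rw [Formula.realize_equal, Term.realize_relabel, Sum.elim_comp_inr, hτ]
    simpa using (mul_eq_X_pow_add_sum_iff hj a b c).1 hab s

/-- **Irreducibility of `Xⁿ + c_{n−1}X^{n−1} + ⋯ + c_0` (`n ≥ 1`) is an elementary property of
`c = (c_0, …, c_{n−1})`, uniformly in all fields**: there is a ring formula `Irr_n(c)` with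
`K ⊨ Irr_n(c) ↔ Xⁿ + Σ_{i<n} c_i X^i` irreducible in `K[X]`, for every field `K`. (`Irr_n` = "no
monic factorization of degrees `(j, n − j)`, `1 ≤ j ≤ n − 1`", by
`Polynomial.Monic.irreducible_iff_natDegree`.) This is what makes "enriched" (pseudo-)finite
fields (CDM (2.6)) first-order axiomatizable in the language of rings, with the constants as
variables. [folklore] -/
theorem exists_formula_irreducible (n : ℕ) (hn : 0 < n) :
    ∃ θ : Language.ring.Formula (Fin n),
      ∀ (K : Type u) [Field K] [CompatibleRing K] (c : Fin n → K),
        θ.Realize c ↔ Irreducible (X ^ n + ∑ i : Fin n, C (c i) * X ^ (i : ℕ)) := by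
  have hB := fun j : Fin (n - 1) => exists_formula_mul_eq.{u} n (j.1 + 1) (by omega)
  choose θ hθ using hB
  refine ⟨Formula.iInf fun j => (θ j).not, fun K _ _ c => ?_⟩
  rw [Formula.realize_iInf]
  simp only [Formula.realize_not, hθ]
  have hp : (X ^ n + ∑ i : Fin n, C (c i) * X ^ (i : ℕ)).Monic := monic_X_pow_add_sum c
  have hpd : (X ^ n + ∑ i : Fin n, C (c i) * X ^ (i : ℕ)).natDegree = n :=
    natDegree_X_pow_add_sum c
  rw [hp.irreducible_iff_natDegree]
  constructor
  · intro H
    refine ⟨fun h1 => ?_, fun f g hf hg hfg => ?_⟩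
    · rw [h1, natDegree_one] at hpd
      omega
    · by_contra hne
      push Not at hne
      have hsum : f.natDegree + g.natDegree = n := by
        rw [← hf.natDegree_mul hg, hfg, hpd]
      have hj : f.natDegree - 1 < n - 1 := by omega
      refine H ⟨f.natDegree - 1, hj⟩ ⟨fun u => f.coeff u, fun w => g.coeff w, ?_⟩
      rw [X_pow_add_sum_coeff_eq hf (d := f.natDegree - 1 + 1) (by omega),
        X_pow_add_sum_coeff_eq hg (d := n - (f.natDegree - 1 + 1)) (by omega), hfg]
  · rintro ⟨-, H⟩ j ⟨a, b, hab⟩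
    rcases H _ _ (monic_X_pow_add_sum a) (monic_X_pow_add_sum b) hab with h | h
    · rw [natDegree_X_pow_add_sum] at h
      omega
    · rw [natDegree_X_pow_add_sum] at h
      omega

/-- **"`c` is an enrichment of depth `B`" is elementary** (CDM (2.6): for each `k < B` the
constants `c ⟨k, i⟩`, `i < k + 2`, are the lower coefficients of an irreducible monic polynomial
`T^{k+2} + Σ_{i<k+2} c_{k,i} T^i`): one ring formula `Enr_B` in the variables
`Σ k : Fin B, Fin (k + 2)` expresses it in every field.
[cite: ChatzidakisVanDenDriesMacintyre1992, (2.6)] -/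
theorem exists_formula_enrichment (B : ℕ) :
    ∃ θ : Language.ring.Formula (Σ k : Fin B, Fin (k.1 + 2)),
      ∀ (K : Type u) [Field K] [CompatibleRing K] (c : (Σ k : Fin B, Fin (k.1 + 2)) → K),
        θ.Realize c ↔
          ∀ k : Fin B,
            Irreducible (X ^ (k.1 + 2) + ∑ i : Fin (k.1 + 2), C (c ⟨k, i⟩) * X ^ (i : ℕ)) := by
  have h := fun k : Fin B => exists_formula_irreducible.{u} (k.1 + 2) (by omega)
  choose θ hθ using h
  refine ⟨Formula.iInf fun k => (θ k).relabel (Sigma.mk k), fun K _ _ c => ?_⟩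
  rw [Formula.realize_iInf]
  refine forall_congr' fun k => ?_
  rw [Formula.realize_relabel, hθ]
  rfl

end IrreducibilityIsElementary

/-! ### CDM (2.7): from enriched pseudo-finite fields to large enriched finite fields -/

section Transfer

/-- **The finite-field clause of CDM Prop. (2.7) from its pseudo-finite clause** ("Such an
equivalence also holds for all sufficiently large enriched finite fields. […] the second part
follows from it by pure logic", p. 118). Hypothesis: for every ring formula `φ(X)`,
`X = (X_1, …, X_m)`, there are an enrichment depth `B` and ring terms `g_1, …, g_L` in `(C, X, T)`
such that `φ(x) ↔ ⋀_l ∃t g_l(c, x, t) = 0` for every pseudo-finite field `K` (an infinite field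
satisfying every sentence true in all finite fields, CDM p. 110), every enrichment `c` of `K` of
depth `B` and every `x ∈ K^m`. Conclusion: the same `B`, `g_l` work in every finite field with at
least `q₀(φ)` elements, for all its enrichments. Proof: `∀c ∀x (Enr_B(c) → (φ(x) ↔ ⋀_l ∃t
g_l(c, x, t) = 0))` is one ring sentence (`exists_formula_enrichment`), true in all pseudo-finite
fields, hence in all large finite fields (`FiniteField.eventually_realize_forall_of_pseudoFinite`,
compactness). [cite: ChatzidakisVanDenDriesMacintyre1992, Prop. 2.7 and p. 118] -/
theorem prop27_finite_of_psf
    (h : ∀ (m : ℕ) (φ : Language.ring.Formula (Fin m)),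
      ∃ (B L : ℕ)
        (g : Fin L → Language.ring.Term (((Σ k : Fin B, Fin (k.1 + 2)) ⊕ Fin m) ⊕ Fin 1)),
        ∀ (K : Type) [Field K] [CompatibleRing K] [Infinite K], K ⊨ finiteFieldTheory →
          ∀ c : (Σ k : Fin B, Fin (k.1 + 2)) → K,
            (∀ k : Fin B, Irreducible (Polynomial.X ^ (k.1 + 2) +
              ∑ i : Fin (k.1 + 2), Polynomial.C (c ⟨k, i⟩) * Polynomial.X ^ (i : ℕ))) →
            ∀ x : Fin m → K,
              (φ.Realize x ↔
                ∀ l, ∃ t : K, (g l).realize (Sum.elim (Sum.elim c x) fun _ => t) = 0)) :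
    ∀ (m : ℕ) (φ : Language.ring.Formula (Fin m)),
      ∃ (B q₀ L : ℕ)
        (g : Fin L → Language.ring.Term (((Σ k : Fin B, Fin (k.1 + 2)) ⊕ Fin m) ⊕ Fin 1)),
        ∀ (K : Type) [Field K] [Fintype K], q₀ ≤ Fintype.card K →
          ∀ c : (Σ k : Fin B, Fin (k.1 + 2)) → K,
            (∀ k : Fin B, Irreducible (Polynomial.X ^ (k.1 + 2) +
              ∑ i : Fin (k.1 + 2), Polynomial.C (c ⟨k, i⟩) * Polynomial.X ^ (i : ℕ))) →
            ∀ x : Fin m → K,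
              (letI := compatibleRingOfRing K;
                (φ.Realize x ↔
                  ∀ l, ∃ t : K, (g l).realize (Sum.elim (Sum.elim c x) fun _ => t) = 0)) := by
  intro m φ
  obtain ⟨B, L, g, hg⟩ := h m φ
  obtain ⟨θE, hθE⟩ := exists_formula_enrichment.{0} B
  -- `ψ_l(C, X) := ∃T g_l(C, X, T) = 0` and `Θ(C, X) := Enr_B(C) → (φ(X) ↔ ⋀_l ψ_l(C, X))`
  let ψ : Fin L → Language.ring.Formula ((Σ k : Fin B, Fin (k.1 + 2)) ⊕ Fin m) := fun l =>
    (Term.equal (g l) 0).iExs (Fin 1)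
  let Θ : Language.ring.Formula ((Σ k : Fin B, Fin (k.1 + 2)) ⊕ Fin m) :=
    (θE.relabel Sum.inl).imp ((φ.relabel Sum.inr).iff (Formula.iInf ψ))
  have hΘ : ∀ (K : Type) [Field K] [CompatibleRing K]
      (c : (Σ k : Fin B, Fin (k.1 + 2)) → K) (x : Fin m → K),
      Θ.Realize (Sum.elim c x) ↔
        ((∀ k : Fin B, Irreducible (Polynomial.X ^ (k.1 + 2) +
            ∑ i : Fin (k.1 + 2), Polynomial.C (c ⟨k, i⟩) * Polynomial.X ^ (i : ℕ))) →
          (φ.Realize x ↔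
            ∀ l, ∃ t : K, (g l).realize (Sum.elim (Sum.elim c x) fun _ => t) = 0)) := by
    intro K _ _ c x
    simp only [Θ, ψ, Formula.realize_imp, Formula.realize_iff, Formula.realize_relabel,
      Formula.realize_iInf, Formula.realize_iExs, Formula.realize_equal, realize_zero,
      Sum.elim_comp_inl, Sum.elim_comp_inr, hθE]
    refine imp_congr_right fun _ => iff_congr Iff.rfl (forall_congr' fun l => ?_)
    constructor
    · rintro ⟨i, hi⟩
      refine ⟨i 0, ?_⟩
      have hi0 : (fun _ : Fin 1 => i 0) = i := funext fun o => by rw [Fin.fin_one_eq_zero o]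
      rw [hi0]
      exact hi
    · rintro ⟨t, ht⟩
      exact ⟨fun _ => t, ht⟩
  obtain ⟨q₀, hq₀⟩ := FiniteField.eventually_realize_forall_of_pseudoFinite Θ
    fun K _ _ _ hK v => by
      rw [← Sum.elim_comp_inl_inr v, hΘ K]
      exact fun hc => hg K hK _ hc _
  refine ⟨B, q₀, L, g, fun K _ _ hK c hc x => ?_⟩
  letI := compatibleRingOfRing K
  exact (hΘ K c x).1 (hq₀ K hK (Sum.elim c x)) hc

/-- **The CDM Main Theorem from CDM Prop. (3.3) and the pseudo-finite clause of CDM Prop. (2.7),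
both as printed.** `h33` is Proposition (3.3) verbatim (with `d ≤ n` for `d ≤ dim V`): Lang–Weil
for arbitrary affine algebraic sets `V(f_1, …, f_r) ⊆ 𝔸ⁿ`, `deg f_i ≤ e`, over finite fields.
`h27` is the principal clause of Proposition (2.7) verbatim: "Each `L(c)`-formula `φ(X)` is
equivalent, uniformly for all enriched pseudo-finite fields, to a conjunction of formulas
`∃T (g(c, X, T) = 0)`, with `g(C, X, T) ∈ ℤ[C, X, T]`" — pseudo-finite fields being the infinite
models of the theory of finite fields (CDM p. 110; `finiteFieldTheory`), enrichments as in (2.6)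
(`c ⟨k, i⟩` = coefficient of `T^i` of the irreducible monic polynomial of degree `k + 2`), ring
formulas `φ` in `X = (X_1, …, X_m)` (an `L(c)`-formula is an `L`-formula with some variables
evaluated at constants, so nothing is lost), the `g_l` ring terms in `(C, X, T)`. Everything
else — the finite-field clause of (2.7) (`prop27_finite_of_psf`), the existence of enrichments
(2.6), Lemma (3.5), the normal form (3)–(4) and the counting (5)–(9) of pp. 123–125, and the
absorption of small fields — is proved in this file and its siblings.
[cite: ChatzidakisVanDenDriesMacintyre1992, Prop. 3.3, Prop. 2.7, Thm. 3.7] -/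
theorem mainTheorem_of_prop33_of_prop27psf
    (h33 : ∀ (e n r : ℕ), ∃ (C : ℝ) (M : ℕ), 0 < C ∧
      ∀ (K : Type) [Field K] [Fintype K] (f : Fin r → MvPolynomial (Fin n) K),
        (∀ i, (f i).totalDegree ≤ e) →
          Nat.card {y : Fin n → K // ∀ i, MvPolynomial.eval y (f i) = 0} = 0 ∨
            ∃ d μ : ℕ, (d ≤ n ∧ 1 ≤ μ ∧ μ ≤ M) ∧
              |(Nat.card {y : Fin n → K // ∀ i, MvPolynomial.eval y (f i) = 0} : ℝ)
                  - μ * (Fintype.card K : ℝ) ^ d|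
                ≤ C * (Fintype.card K : ℝ) ^ ((d : ℝ) - 1 / 2))
    (h27 : ∀ (m : ℕ) (φ : Language.ring.Formula (Fin m)),
      ∃ (B L : ℕ)
        (g : Fin L → Language.ring.Term (((Σ k : Fin B, Fin (k.1 + 2)) ⊕ Fin m) ⊕ Fin 1)),
        ∀ (K : Type) [Field K] [CompatibleRing K] [Infinite K], K ⊨ finiteFieldTheory →
          ∀ c : (Σ k : Fin B, Fin (k.1 + 2)) → K,
            (∀ k : Fin B, Irreducible (Polynomial.X ^ (k.1 + 2) +
              ∑ i : Fin (k.1 + 2), Polynomial.C (c ⟨k, i⟩) * Polynomial.X ^ (i : ℕ))) →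
            ∀ x : Fin m → K,
              (φ.Realize x ↔
                ∀ l, ∃ t : K, (g l).realize (Sum.elim (Sum.elim c x) fun _ => t) = 0)) :
    ChatzidakisVanDenDriesMacintyre1992_mainTheorem :=
  mainTheorem_of_prop33_of_prop27 h33 (prop27_finite_of_psf h27)

end Transfer

/-! ### From large finite fields to pseudo-finite fields; irreducible polynomials of every degree -/

section PsfBasics

open Polynomial
open scoped Cardinal

/-- **Transfer from large finite fields to pseudo-finite fields.** A ring sentence true in every
finite field with at least `q₀` elements is true in every pseudo-finite field (every infinite
model of the theory of finite fields): the sentence "`|K| ≥ q₀ → σ`" is true in ALL finite fields,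
hence belongs to the theory of finite fields, and an infinite model satisfies `|K| ≥ q₀`. This is
the direction of transfer by which the algebraic properties of pseudo-finite fields (perfectness,
extensions of every degree, PAC, CDM (2.1)–(2.5)) are read off from the finite fields.
[folklore] [cite: ChatzidakisVanDenDriesMacintyre1992, p. 110 and (2.3)] -/
theorem realize_sentence_of_forall_finite (σ : Language.ring.Sentence) (q₀ : ℕ)
    (h : ∀ (F : Type) [Field F] [Fintype F], q₀ ≤ Fintype.card F →
      (letI := compatibleRingOfRing F; F ⊨ σ))
    (K : Type*) [Field K] [CompatibleRing K] [Infinite K] (hK : K ⊨ finiteFieldTheory) :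
    K ⊨ σ := by
  have hmem : (Sentence.cardGe Language.ring q₀).imp σ ∈ finiteFieldTheory := by
    intro F _ _
    letI := compatibleRingOfRing F
    rw [Sentence.realize_imp, Sentence.realize_cardGe, Cardinal.mk_fintype, Nat.cast_le]
    exact h F
  have hKσ := hK.realize_of_mem _ hmem
  rw [Sentence.realize_imp] at hKσ
  exact hKσ ((Sentence.realize_cardGe (M := K) Language.ring q₀).2
    ((Cardinal.natCast_lt_aleph0 (n := q₀)).le.trans (Cardinal.aleph0_le_mk K)))

/-- Transfer of a uniform property with free variables from large finite fields to pseudo-finite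
fields: if a ring formula `φ(v)` holds identically in every finite field with at least `q₀`
elements, it holds identically in every pseudo-finite field. [folklore]
[cite: ChatzidakisVanDenDriesMacintyre1992, p. 110 and (2.3)] -/
theorem realize_formula_of_forall_finite {α : Type} [Finite α] (φ : Language.ring.Formula α)
    (q₀ : ℕ)
    (h : ∀ (F : Type) [Field F] [Fintype F], q₀ ≤ Fintype.card F →
      ∀ v : α → F, (letI := compatibleRingOfRing F; φ.Realize v))
    (K : Type*) [Field K] [CompatibleRing K] [Infinite K] (hK : K ⊨ finiteFieldTheory)
    (v : α → K) : φ.Realize v := by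
  have hσ := realize_sentence_of_forall_finite
    ((φ.relabel (Sum.inr : α → Empty ⊕ α)).iAlls α) q₀ (fun F _ _ hF => by
      letI := compatibleRingOfRing F
      exact (realize_iAlls_relabel_inr_iff φ F).2 (h F hF)) K hK
  exact (realize_iAlls_relabel_inr_iff φ K).1 hσ v

/-- A formula with all its variables existentially quantified holds in `M` iff some valuation
satisfies the formula (mirror of `realize_iAlls_relabel_inr_iff`). [folklore] -/
theorem realize_iExs_inr_iff {α : Type} [Finite α] (φ : Language.ring.Formula α)
    (M : Type*) [Language.ring.Structure M] [Nonempty M] :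
    M ⊨ ((φ.relabel (Sum.inr : α → Empty ⊕ α)).iExs α) ↔ ∃ v : α → M, φ.Realize v := by
  rw [Sentence.Realize, Formula.realize_iExs]
  refine exists_congr fun v => ?_
  rw [Formula.realize_relabel]
  exact Iff.of_eq (congrArg φ.Realize (funext fun a => rfl))

/-- **A pseudo-finite field has irreducible polynomials of every positive degree** (hence a field
extension of every degree; CDM (2.5): a pseudo-finite field "has exactly one extension of each
degree" — the existence half). Proof: "there is an irreducible monic polynomial of degree `m`" is
the ring sentence `∃c Irr_m(c)` (`exists_formula_irreducible`), true in every finite field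
(`exists_monic_irreducible_natDegree_eq`), hence in every pseudo-finite field
(`realize_sentence_of_forall_finite`). [cite: ChatzidakisVanDenDriesMacintyre1992, (2.5)]
[cite: Ax1968, §1] -/
theorem exists_monic_irreducible_of_model_finiteFieldTheory (K : Type) [Field K]
    [CompatibleRing K] [Infinite K] (hK : K ⊨ finiteFieldTheory) {m : ℕ} (hm : 0 < m) :
    ∃ μ : K[X], μ.Monic ∧ Irreducible μ ∧ μ.natDegree = m := by
  obtain ⟨θ, hθ⟩ := exists_formula_irreducible.{0} m hm
  have hK' := realize_sentence_of_forall_finite ((θ.relabel (Sum.inr : Fin m → Empty ⊕ Fin m)).iExs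
    (Fin m)) 0 (fun F _ _ _ => by
      letI := compatibleRingOfRing F
      rw [realize_iExs_inr_iff]
      obtain ⟨μ, hμm, hμi, hμd⟩ := exists_monic_irreducible_natDegree_eq F hm
      refine ⟨fun i => μ.coeff i, (hθ F _).2 ?_⟩
      rw [X_pow_add_sum_coeff_eq hμm hμd]
      exact hμi) K hK
  rw [realize_iExs_inr_iff] at hK'
  obtain ⟨c, hc⟩ := hK'
  exact ⟨_, monic_X_pow_add_sum c, (hθ K c).1 hc, natDegree_X_pow_add_sum c⟩

end PsfBasics

end Literature.ModelTheory.PseudofiniteFields
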